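import Summits.Schanuel.Schanuel.Theorems.ZilberEacGraphLiftTorus
import Summits.Schanuel.Schanuel.Theorems.ZilberEacDensityLiftRank
import Mathlib.FieldTheory.IntermediateField.Adjoin.Algebra
import HarnessLib

/-!
# The graph lift `W^f(S)`, III: rotundity

Zilber's Exponential-Algebraic Closedness, case ladder (host summit Schanuel, cell `pub-schanuel`,
seat 2, gen 6).  For `S ⊆ ℂⁿ × ℂⁿ` irreducible closed meeting `Gⁿ` with ROTUND torus part and any
`f ∈ ℂ[x]`, the torus part of the graph lift `W^f(S) = {s ∈ S, x_last = f(x_s)}` (`ZilberEacGraphLift`,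
`y_last` free) is rotund (`isRotund_graphVar_of_isRotund`).  The proof is that of
`isRotund_liftVar_of_isRotund` (`ZilberEacDensityLiftRotund`) with the roles of the two new coordinates
exchanged: at the generic point `ξ = (ξ_S, f(x̄); ȳ, v)` the small coordinates form a generic point of
`S` (`graph_aeval_pr_eq_zero_iff`) and now the last MULTIPLICATIVE coordinate `v` is transcendental over
`ℂ[ξ_S]` (`graph_transcendental_last`), hence over `ℂ(ξ_S)`; for `M ∈ M_{n+1}(ℤ)` with some
`M_{i₀,last} = c₀ ≠ 0` the transcendental witness is the multiplicative coordinate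
`m_{i₀} = ȳ^{M'_{i₀}} · v^{c₀}` (`transcendental_mul_zpow_of_transcendental`), while the rows
`c₀ · row_k - c_k · row_{i₀}` again give a matrix `N ∈ Mₙ(ℤ)` with `rk N + 1 ≥ rk M` whose action on
`ξ_S` has coordinates algebraic over `ℂ[[M] ξ]` (the multiples of `f(x̄)` and the powers of `v`
cancel); the case of a vanishing last column is verbatim the same.  With `ZilberEacGraphLiftTorus` this
gives the column monotonicity `ECCell (n+1) d → ECCell n d` (`ZilberEacDensityConverse`).

HONEST FRAMING: a certificate lemma (the graph lift preserves the hypotheses of Zilber's conjecture);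
no case of EAC is proved; nothing here bears on Schanuel's conjecture (EAC ⇏ SC).
-/

noncomputable section

open MvPolynomial
open Literature.NumberTheory.Transcendental Literature.ModelTheory.Zilber
open scoped IntermediateField.algebraAdjoinAdjoin

set_option linter.dupNamespace false

namespace Summit.Schanuel.Schanuel.Theorems

/-! ## The generic point of the graph lift -/

section GenericPoint

variable {d : ℕ} (f : MvPolynomial (Fin d) ℂ) {S : Set (Fin d ⊕ Fin d → ℂ)}
variable {E : Type*} [Field E] [Algebra ℂ E] {ξ : Fin (d + 1) ⊕ Fin (d + 1) → E}

/-- **The small coordinates of a generic point of `W^f(S)` form a generic point of `S`**: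
`f(ξ_S) = 0 ↔ f ∈ I(S)`. [folklore] -/
theorem graph_aeval_pr_eq_zero_iff (hξ : IsGenericPt (vanishingIdeal ℂ (graphVar f S)) ξ)
    (f : MvPolynomial (Fin d ⊕ Fin d) ℂ) :
    aeval (fun t : Fin d ⊕ Fin d => ξ (Sum.map Fin.castSucc Fin.castSucc t)) f = 0 ↔
      f ∈ vanishingIdeal ℂ S := by
  have h1 : aeval (fun t : Fin d ⊕ Fin d => ξ (Sum.map Fin.castSucc Fin.castSucc t)) f =
      aeval ξ (rename (Sum.map (Fin.castSucc (n := d)) (Fin.castSucc (n := d))) f) := by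
    rw [aeval_rename]
    rfl
  rw [h1, hξ, mem_vanishingIdeal_graphVar_iff, graphHom_rename]
  constructor
  · intro h
    simpa only [Polynomial.coeff_C_zero] using h 0
  · intro h k
    rw [Polynomial.coeff_C]
    split_ifs
    · exact h
    · exact Ideal.zero_mem _

/-- **`y_last` is transcendental over `ℂ[ξ_S]`** at a generic point `ξ` of `W^f(S)`: a relation
`∑ cₖ(ξ_S) v^k = 0` lifts to `∑ cₖ(x,y) y_last^k ∈ I(W^f(S))`, whose image `∑ cₖ T^k` under
`graphHom` has all coefficients in `I(S)`. [folklore] -/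
theorem graph_transcendental_last (hξ : IsGenericPt (vanishingIdeal ℂ (graphVar f S)) ξ) :
    Transcendental (Algebra.adjoin ℂ (Set.range
        (fun t : Fin d ⊕ Fin d => ξ (Sum.map Fin.castSucc Fin.castSucc t))))
      (ξ (Sum.inr (Fin.last d))) := by
  classical
  set ξS : Fin d ⊕ Fin d → E := fun t => ξ (Sum.map Fin.castSucc Fin.castSucc t) with hξS
  set R := Algebra.adjoin ℂ (Set.range ξS) with hR
  rintro ⟨p, hp0, hpu⟩
  have hcoef : ∀ k, ∃ c : MvPolynomial (Fin d ⊕ Fin d) ℂ, aeval ξS c = ((p.coeff k : R) : E) := by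
    intro k
    have hmem : ((p.coeff k : R) : E) ∈ Algebra.adjoin ℂ (Set.range ξS) := (p.coeff k).2
    rw [Algebra.adjoin_range_eq_range_aeval] at hmem
    exact hmem
  choose c hc using hcoef
  set q : MvPolynomial (Fin (d + 1) ⊕ Fin (d + 1)) ℂ :=
    ∑ k ∈ p.support, rename (Sum.map (Fin.castSucc (n := d)) (Fin.castSucc (n := d))) (c k) *
      X (Sum.inr (Fin.last d)) ^ k with hq
  have haq : aeval ξ q = Polynomial.aeval (ξ (Sum.inr (Fin.last d))) p := by
    rw [hq, map_sum, Polynomial.aeval_def, Polynomial.eval₂_eq_sum, Polynomial.sum_def]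
    refine Finset.sum_congr rfl fun k _ => ?_
    rw [map_mul, map_pow, aeval_X, aeval_rename]
    change aeval ξS (c k) * _ = _
    rw [hc k]
    rfl
  have hqP : q ∈ vanishingIdeal ℂ (graphVar f S) := by
    rw [← hξ q, haq, hpu]
  rw [mem_vanishingIdeal_graphVar_iff] at hqP
  have hlift : graphHom f q = ∑ k ∈ p.support, Polynomial.C (c k) * Polynomial.X ^ k := by
    rw [hq, map_sum]
    refine Finset.sum_congr rfl fun k _ => ?_
    rw [map_mul, map_pow, graphHom_rename, graphHom_X_inr_last]
  apply hp0
  refine Polynomial.ext fun k => ?_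
  rw [Polynomial.coeff_zero]
  by_cases hk : k ∈ p.support
  · have h1 := hqP k
    rw [hlift, Polynomial.finsetSum_coeff] at h1
    simp only [Polynomial.coeff_C_mul_X_pow] at h1
    rw [Finset.sum_ite_eq, if_pos hk] at h1
    have h2 : aeval ξS (c k) = 0 := (graph_aeval_pr_eq_zero_iff f hξ (c k)).2 h1
    rw [hc k] at h2
    exact_mod_cast h2
  · exact Polynomial.notMem_support_iff.1 hk

end GenericPoint

/-! ## Rotundity of the graph lift in every dimension -/

/-- `r · u^c` is transcendental over a subalgebra `R` closed under inverses, for `r ∈ R` nonzero,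
`c ≠ 0` and `u` transcendental over `R`. [folklore] -/
theorem transcendental_mul_zpow_of_transcendental {F E : Type*} [Field F] [Field E] [Algebra F E]
    {R : Subalgebra F E} (hRinv : ∀ x ∈ R, x⁻¹ ∈ R) {r u : E} (hr : r ∈ R) (hr0 : r ≠ 0)
    {c : ℤ} (hc : c ≠ 0) (hu : Transcendental R u) : Transcendental R (r * u ^ c) := by
  intro halg
  apply hu
  have h1 : IsAlgebraic R (u ^ c) := by
    have := (isAlgebraic_algebraMap (⟨r⁻¹, hRinv r hr⟩ : R)).mul halg
    rwa [show (algebraMap R E ⟨r⁻¹, hRinv r hr⟩ : E) = r⁻¹ from rfl, ← mul_assoc,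
      inv_mul_cancel₀ hr0, one_mul] at this
  rcases Int.natAbs_eq c with hc' | hc'
  · rw [hc', zpow_natCast] at h1
    exact IsAlgebraic.of_pow (Int.natAbs_pos.2 hc) h1
  · rw [hc', zpow_neg, zpow_natCast, IsAlgebraic.inv_iff] at h1
    exact IsAlgebraic.of_pow (Int.natAbs_pos.2 hc) h1

variable {n : ℕ} (f : MvPolynomial (Fin n) ℂ) {S : Set (Fin n ⊕ Fin n → ℂ)}

set_option maxHeartbeats 800000 in
/-- **The graph lift preserves rotundity** (every dimension).  For `S ⊆ ℂⁿ × ℂⁿ` irreducible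
closed meeting `Gⁿ` whose torus part is rotund, and any `f ∈ ℂ[x]`, the torus part of
`W^f(S) ⊆ ℂ^{n+1} × ℂ^{n+1}` is rotund. [cite: BaysKirby2018ANT, Prop. 7.3 (proof)] -/
theorem isRotund_graphVar_of_isRotund (hS : IsIrreducibleClosed ℂ S) (hne : (S ∩ torusLocus ℂ n).Nonempty)
    (hrot : IsRotund ℂ n (S ∩ torusLocus ℂ n)) :
    IsRotund ℂ (n + 1) (graphVar f S ∩ torusLocus ℂ (n + 1)) := by
  classical
  -- the lift as `Z(P)`, `P` prime; `S` as `Z(P_S)`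
  have hWirr : IsIrreducibleClosed ℂ (graphVar f S) := isIrreducibleClosed_graphVar f hS
  set P := vanishingIdeal ℂ (graphVar f S) with hP
  haveI : P.IsPrime := hWirr.2
  have hWZ : graphVar f S = zeroLocus ℂ P := eq_zeroLocus_vanishingIdeal_of_isZariskiClosed hWirr.1
  have hneP : (zeroLocus ℂ P ∩ torusLocus ℂ (n + 1)).Nonempty := by
    rw [← hWZ]
    exact graphVar_inter_torusLocus_nonempty f hne
  set PS := vanishingIdeal ℂ S with hPS
  haveI : PS.IsPrime := hS.2
  have hSZ : S = zeroLocus ℂ PS := eq_zeroLocus_vanishingIdeal_of_isZariskiClosed hS.1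
  have hnePS : (zeroLocus ℂ PS ∩ torusLocus ℂ n).Nonempty := by rwa [← hSZ]
  -- generic points, the ring `R = ℂ[ξ_S]` and the field `K_S = ℂ(ξ_S)`
  set ξ : Fin (n + 1) ⊕ Fin (n + 1) → zeroLocusFunctionField P := genericPt P with hξdef
  have hξ : IsGenericPt P ξ := isGenericPt_genericPt P
  have hξT : ξ ∈ torusLocus (zeroLocusFunctionField P) (n + 1) :=
    genericPt_mem_torusLocus P (X_inr_notMem_of_nonempty P hneP)
  set ξS : Fin n ⊕ Fin n → zeroLocusFunctionField P :=
    fun t => ξ (Sum.map Fin.castSucc Fin.castSucc t) with hξS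
  have hξS_gen : IsGenericPt PS ξS := fun g => graph_aeval_pr_eq_zero_iff f hξ g
  set R : Subalgebra ℂ (zeroLocusFunctionField P) := Algebra.adjoin ℂ (Set.range ξS) with hR
  set KS : IntermediateField ℂ (zeroLocusFunctionField P) :=
    IntermediateField.adjoin ℂ (Set.range ξS) with hKS
  have hu : Transcendental R (ξ (Sum.inr (Fin.last n))) := graph_transcendental_last f hξ
  have huK : Transcendental KS (ξ (Sum.inr (Fin.last n))) := fun h => hu (h.restrictScalars R)
  -- freeze the generic point and the prime (no further unfolding is needed)
  clear_value ξ P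
  have hintK : ∀ m : ℤ, (m : zeroLocusFunctionField P) ∈ KS := fun m => by
    rw [← map_intCast (algebraMap ℂ (zeroLocusFunctionField P))]; exact KS.algebraMap_mem _
  -- coordinates of `[M] ξ`
  have hadd_coord : ∀ (M : Matrix (Fin (n + 1)) (Fin (n + 1)) ℤ) (i : Fin (n + 1)),
      matrixAct M ξ (Sum.inl i) =
        (∑ j : Fin n, (M i (Fin.castSucc j) : zeroLocusFunctionField P) * ξS (Sum.inl j)) +
          (M i (Fin.last n) : zeroLocusFunctionField P) * ξ (Sum.inl (Fin.last n)) := by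
    intro M i
    rw [matrixAct_inl, Fin.sum_univ_castSucc]
    rfl
  have hmul_coord : ∀ (M : Matrix (Fin (n + 1)) (Fin (n + 1)) ℤ) (i : Fin (n + 1)),
      matrixAct M ξ (Sum.inr i) = (∏ j : Fin n, ξS (Sum.inr j) ^ M i (Fin.castSucc j)) *
        ξ (Sum.inr (Fin.last n)) ^ M i (Fin.last n) := by
    intro M i
    rw [matrixAct_inr, Fin.prod_univ_castSucc]
    rfl
  -- finiteness of the transcendence degrees of finitely generated subalgebras
  have hfin : ∀ {ι : Type} [Fintype ι] (v : ι → zeroLocusFunctionField P),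
      Algebra.trdeg ℂ (Algebra.adjoin ℂ (Set.range v)) =
        (Cardinal.toNat (Algebra.trdeg ℂ (Algebra.adjoin ℂ (Set.range v))) : Cardinal) := by
    intro ι _ v
    haveI : Algebra.FiniteType ℂ (aeval v : MvPolynomial ι ℂ →ₐ[ℂ] zeroLocusFunctionField P).range :=
      Algebra.FiniteType.of_surjective (aeval v).rangeRestrict (AlgHom.rangeRestrict_surjective _)
    rw [Algebra.adjoin_range_eq_range_aeval]
    exact Literature.RingTheory.KrullDimension.trdeg_eq_toNat ℂ _
  -- rotundity of `S ∩ Gⁿ` read at `ξ_S`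
  have hrotN : ∀ N : Matrix (Fin n) (Fin n) ℤ, (((N.map (Int.cast : ℤ → ℚ)).rank : ℕ) : Cardinal) ≤
      Algebra.trdeg ℂ (Algebra.adjoin ℂ (Set.range (matrixAct N ξS))) := by
    intro N
    have h := hrot N
    rw [hSZ, zariskiDim_image_matrixAct_eq PS hξS_gen hnePS N, ← Algebra.adjoin_range_eq_range_aeval] at h
    rw [hfin]
    exact_mod_cast h
  rw [hWZ]
  intro M
  rw [zariskiDim_image_matrixAct_eq P hξ hneP M, ← Algebra.adjoin_range_eq_range_aeval]
  set AM : Subalgebra ℂ (zeroLocusFunctionField P) := Algebra.adjoin ℂ (Set.range (matrixAct M ξ)) with hAM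
  -- it suffices to bound the rank by the transcendence degree, as cardinals
  suffices key : (((M.map (Int.cast : ℤ → ℚ)).rank : ℕ) : Cardinal) ≤ Algebra.trdeg ℂ AM by
    rw [hAM, hfin] at key
    exact_mod_cast key
  have hmemAM : ∀ j, matrixAct M ξ j ∈ AM := fun j => Algebra.subset_adjoin ⟨j, rfl⟩
  have hintAM : ∀ m : ℤ, (m : zeroLocusFunctionField P) ∈ AM := fun m => by
    rw [← map_intCast (algebraMap ℂ (zeroLocusFunctionField P))]; exact AM.algebraMap_mem _
  set Mq := M.map (Int.cast : ℤ → ℚ) with hMq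
  by_cases hcol : ∃ i₀, M i₀ (Fin.last n) ≠ 0
  · -- CASE B: `c₀ = M_{i₀, last} ≠ 0`
    obtain ⟨i₀, hc₀⟩ := hcol
    set σ := Fin.succAbove i₀ with hσ
    set N : Matrix (Fin n) (Fin n) ℤ := Matrix.of fun k j =>
      M i₀ (Fin.last n) * M (σ k) (Fin.castSucc j) - M (σ k) (Fin.last n) * M i₀ (Fin.castSucc j) with hN
    -- rank: `rk M ≤ rk N + 1`
    have hrank : Mq.rank ≤ (N.map (Int.cast : ℤ → ℚ)).rank + 1 := by
      set w : Fin n → Fin (n + 1) → ℚ := fun k =>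
        (M i₀ (Fin.last n) : ℚ) • Mq (σ k) - (M (σ k) (Fin.last n) : ℚ) • Mq i₀ with hw
      have hwlast : ∀ k, w k (Fin.last n) = 0 := by
        intro k
        simp only [hw, hMq, Pi.sub_apply, Pi.smul_apply, Matrix.map_apply, smul_eq_mul]
        ring
      have hwN : (Matrix.of fun k j => w k (Fin.castSucc j) : Matrix (Fin n) (Fin n) ℚ) =
          N.map (Int.cast : ℤ → ℚ) := by
        ext k j
        simp only [hw, hN, hMq, Matrix.of_apply, Matrix.map_apply, Pi.sub_apply, Pi.smul_apply,
          smul_eq_mul, Int.cast_sub, Int.cast_mul]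
      have hc₀q : (M i₀ (Fin.last n) : ℚ) ≠ 0 := by exact_mod_cast hc₀
      set T := Submodule.span ℚ (insert (Mq i₀) (Set.range w)) with hT
      have h1 : Mq.rank ≤ Module.finrank ℚ T := by
        refine rank_le_finrank_span_insert Mq i₀ T (Submodule.subset_span (Set.mem_insert _ _)) ?_
        intro k
        have hk : Mq (σ k) = (M i₀ (Fin.last n) : ℚ)⁻¹ • (w k + (M (σ k) (Fin.last n) : ℚ) • Mq i₀) := by
          simp only [hw, sub_add_cancel, smul_smul, inv_mul_cancel₀ hc₀q, one_smul]
        rw [hk]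
        refine T.smul_mem _ (T.add_mem ?_ (T.smul_mem _ ?_))
        · exact Submodule.subset_span (Set.mem_insert_of_mem _ ⟨k, rfl⟩)
        · exact Submodule.subset_span (Set.mem_insert _ _)
      have h2 : Module.finrank ℚ T ≤ 1 + Module.finrank ℚ (Submodule.span ℚ (Set.range w)) := by
        rw [hT, Submodule.span_insert]
        have ha := finrank_span_singleton_le_one (Mq i₀)
        have hb := Submodule.finrank_add_le_finrank_add_finrank
          (Submodule.span ℚ ({Mq i₀} : Set (Fin (n + 1) → ℚ))) (Submodule.span ℚ (Set.range w))
        omega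
      have h3 := finrank_span_range_eq_rank_truncate w hwlast
      rw [hwN] at h3
      omega
    -- the coordinates of `[N] ξ_S` are algebraic over `AM = ℂ[[M] ξ]`
    have halgN : ∀ j : Fin n ⊕ Fin n, IsAlgebraic AM (matrixAct N ξS j) := by
      rintro (k | k)
      · -- additive: an integer combination of two additive coordinates of `[M] ξ`
        have heq : matrixAct N ξS (Sum.inl k) =
            (M i₀ (Fin.last n) : zeroLocusFunctionField P) * matrixAct M ξ (Sum.inl (σ k)) -
              (M (σ k) (Fin.last n) : zeroLocusFunctionField P) * matrixAct M ξ (Sum.inl i₀) := by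
          rw [matrixAct_inl, hadd_coord, hadd_coord]
          have hterm : ∀ j : Fin n, ((N k j : ℤ) : zeroLocusFunctionField P) * ξS (Sum.inl j) =
              (M i₀ (Fin.last n) : zeroLocusFunctionField P) *
                  ((M (σ k) (Fin.castSucc j) : zeroLocusFunctionField P) * ξS (Sum.inl j)) -
                (M (σ k) (Fin.last n) : zeroLocusFunctionField P) *
                  ((M i₀ (Fin.castSucc j) : zeroLocusFunctionField P) * ξS (Sum.inl j)) := by
            intro j
            simp only [hN, Matrix.of_apply, Int.cast_sub, Int.cast_mul]
            ring
          rw [Finset.sum_congr rfl (fun j _ => hterm j), Finset.sum_sub_distrib, ← Finset.mul_sum,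
            ← Finset.mul_sum]
          ring
        have hmem : matrixAct N ξS (Sum.inl k) ∈ AM := by
          rw [heq]
          exact AM.sub_mem (AM.mul_mem (hintAM _) (hmemAM _)) (AM.mul_mem (hintAM _) (hmemAM _))
        exact isAlgebraic_algebraMap (⟨_, hmem⟩ : AM)
      · -- multiplicative: `z · m_{i₀}^{c_k} = m_{σ k}^{c₀}`, then clear signs of exponents
        have hm0 : ∀ i, matrixAct M ξ (Sum.inr i) ≠ 0 := fun i => matrixAct_mem_torusLocus M hξT i
        have hy0 : ∀ j, ξS (Sum.inr j) ≠ 0 := fun j => hξT (Fin.castSucc j)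
        have hzpow : matrixAct N ξS (Sum.inr k) * matrixAct M ξ (Sum.inr i₀) ^ M (σ k) (Fin.last n) =
            matrixAct M ξ (Sum.inr (σ k)) ^ M i₀ (Fin.last n) := by
          rw [matrixAct_inr, hmul_coord, hmul_coord, mul_zpow, mul_zpow, ← Finset.prod_zpow,
            ← Finset.prod_zpow, ← zpow_mul, ← zpow_mul, mul_comm (M i₀ (Fin.last n)) (M (σ k) (Fin.last n)),
            ← mul_assoc]
          congr 1
          rw [← Finset.prod_mul_distrib]
          refine Finset.prod_congr rfl fun j _ => ?_
          rw [← zpow_mul, ← zpow_mul, ← zpow_add₀ (hy0 j)]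
          simp only [hN, Matrix.of_apply]
          congr 1
          ring
        have key := pow_one_mul_eq_of_mul_zpow_eq (hm0 i₀) (hm0 (σ k)) hzpow
        refine isAlgebraic_of_pow_mul_eq one_pos ?_ ?_ ?_ key
        · exact AM.mul_mem (AM.pow_mem (hmemAM _) _) (AM.pow_mem (hmemAM _) _)
        · exact AM.mul_mem (AM.pow_mem (hmemAM _) _) (AM.pow_mem (hmemAM _) _)
        · exact mul_ne_zero (pow_ne_zero _ (hm0 _)) (pow_ne_zero _ (hm0 _))
    -- the transcendental `m_{i₀} = (∏ ξ_S(y)^{M_{i₀}}) · v^{c₀}` over the field `K_S ⊇ ℂ[[N] ξ_S]`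
    have hm₀K : Transcendental KS.toSubalgebra (matrixAct M ξ (Sum.inr i₀)) := by
      rw [hmul_coord]
      refine transcendental_mul_zpow_of_transcendental (R := KS.toSubalgebra)
        (fun x hx => KS.inv_mem hx) ?_ ?_ hc₀ huK
      · exact KS.toSubalgebra.prod_mem fun j _ =>
          KS.pow_mem (IntermediateField.subset_adjoin ℂ _ ⟨Sum.inr j, rfl⟩) _
      · exact Finset.prod_ne_zero_iff.2 fun j _ => zpow_ne_zero _ (hξT (Fin.castSucc j))
    have hNK : Algebra.adjoin ℂ (Set.range (matrixAct N ξS)) ≤ KS.toSubalgebra := by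
      refine Algebra.adjoin_le ?_
      rintro _ ⟨(k | k), rfl⟩
      · rw [matrixAct_inl]
        exact KS.toSubalgebra.sum_mem fun j _ => KS.toSubalgebra.mul_mem (hintK _)
          (IntermediateField.subset_adjoin ℂ _ ⟨Sum.inl j, rfl⟩)
      · rw [matrixAct_inr]
        exact KS.toSubalgebra.prod_mem fun j _ =>
          KS.pow_mem (IntermediateField.subset_adjoin ℂ _ ⟨Sum.inr j, rfl⟩) _
    have hm₀N : Transcendental (Algebra.adjoin ℂ (Set.range (matrixAct N ξS)))
        (matrixAct M ξ (Sum.inr i₀)) :=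
      hm₀K.of_tower_top_of_subalgebra_le hNK
    -- the transcendence-degree chain
    have h1 := trdeg_adjoin_add_one_le_trdeg_adjoin_insert (F := ℂ) (Set.range (matrixAct N ξS)) hm₀N
    have h2 : Algebra.trdeg ℂ (Algebra.adjoin ℂ (insert (matrixAct M ξ (Sum.inr i₀))
        (Set.range (matrixAct N ξS)))) ≤ Algebra.trdeg ℂ AM :=
      Literature.RingTheory.NoetherNormalization.trdeg_adjoin_le_trdeg_adjoin_of_forall_isAlgebraic
        (by
          rintro x (rfl | ⟨j, rfl⟩)
          · exact isAlgebraic_algebraMap (⟨_, hmemAM (Sum.inr i₀)⟩ : AM)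
          · exact halgN j)
    have h3 := hrotN N
    calc ((Mq.rank : ℕ) : Cardinal)
        ≤ (((N.map (Int.cast : ℤ → ℚ)).rank + 1 : ℕ) : Cardinal) := Nat.cast_le.2 hrank
      _ = (((N.map (Int.cast : ℤ → ℚ)).rank : ℕ) : Cardinal) + 1 := by push_cast; rfl
      _ ≤ Algebra.trdeg ℂ (Algebra.adjoin ℂ (Set.range (matrixAct N ξS))) + 1 := add_le_add h3 le_rfl
      _ ≤ _ := h1
      _ ≤ Algebra.trdeg ℂ AM := h2
  · -- CASE A: last column zero
    have hcol' : ∀ i, M i (Fin.last n) = 0 := fun i => by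
      by_contra h
      exact hcol ⟨i, h⟩
    have hdet : M.det = 0 := Matrix.det_eq_zero_of_column_eq_zero (Fin.last n) hcol'
    have hrk : Mq.rank < n + 1 := rank_map_lt_of_det_eq_zero M hdet
    obtain ⟨i_d, hi_d⟩ := exists_row_mem_span_of_rank_lt Mq hrk
    obtain ⟨N, hN⟩ : ∃ N : Matrix (Fin n) (Fin n) ℤ,
        N = Matrix.of fun k j => M (Fin.succAbove i_d k) (Fin.castSucc j) := ⟨_, rfl⟩
    have hrank : Mq.rank ≤ (N.map (Int.cast : ℤ → ℚ)).rank := by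
      have hwlast : ∀ k, (Mq ∘ Fin.succAbove i_d) k (Fin.last n) = 0 := by
        intro k
        simp only [Function.comp_apply, hMq, Matrix.map_apply, hcol', Int.cast_zero]
      have hwN : (Matrix.of fun k j => (Mq ∘ Fin.succAbove i_d) k (Fin.castSucc j) :
          Matrix (Fin n) (Fin n) ℚ) = N.map (Int.cast : ℤ → ℚ) := by
        ext k j
        simp only [hN, hMq, Matrix.of_apply, Matrix.map_apply, Function.comp_apply]
      have h1 := rank_le_finrank_span_insert Mq i_d (Submodule.span ℚ (Set.range (Mq ∘ Fin.succAbove i_d)))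
        hi_d (fun k => Submodule.subset_span ⟨k, rfl⟩)
      have h2 := finrank_span_range_eq_rank_truncate (Mq ∘ Fin.succAbove i_d) hwlast
      rw [hwN] at h2
      omega
    -- coordinates of `[N] ξ_S` are coordinates of `[M] ξ`
    have hNcoord : ∀ j, matrixAct N ξS j =
        matrixAct M ξ (Sum.map (Fin.succAbove i_d) (Fin.succAbove i_d) j) := by
      intro j
      rw [hN]
      exact matrixAct_rows_eq_of_last_col_zero M hcol' ξ ξS (fun t => rfl) i_d j
    have hle : Algebra.adjoin ℂ (Set.range (matrixAct N ξS)) ≤ AM := by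
      refine Algebra.adjoin_le ?_
      rintro _ ⟨j, rfl⟩
      rw [hNcoord j]
      exact hmemAM _
    calc ((Mq.rank : ℕ) : Cardinal)
        ≤ (((N.map (Int.cast : ℤ → ℚ)).rank : ℕ) : Cardinal) := Nat.cast_le.2 hrank
      _ ≤ Algebra.trdeg ℂ (Algebra.adjoin ℂ (Set.range (matrixAct N ξS))) := hrotN N
      _ ≤ Algebra.trdeg ℂ AM :=
          Literature.RingTheory.NoetherNormalization.trdeg_adjoin_le_trdeg_adjoin_of_forall_isAlgebraic
            fun x hx => isAlgebraic_algebraMap (⟨x, hle (Algebra.subset_adjoin hx)⟩ : AM)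

end Summit.Schanuel.Schanuel.Theorems
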